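import Summits.QuantumFields.QCD.Theorems.SpectralDefectExtinctionTipPricingSchurLatticeLocalityAux
import Summits.QuantumFields.QCD.Theorems.SpectralDefectExtinctionTipPricingSchurLocality

/-!
# Lattice Schur-complement locality (lemma G6L of the modular cell–wall template)

Sub-goal G6L of crux stmt-QuantumFields-8967 (`Summit.QuantumFields.QCD.Theses.SpectralDefectExtinction.TipPricing`,
line `hermitian-flow-coarea`, lead c2; consumed by the assembly of stub `stub_spreadOfCells`).  For
`H = Γ₅ (D_W(U) − δ)` on the torus, a big box tiled exactly by disjoint cells-with-collars, `Cl` the quark indices over the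
cells, `Wl` the wall (big box minus cells, the disjoint union of the collars `Co k`): if the wall block and all collar
blocks of `H` have a norm gap `g₀ ∈ (0, 1]`, the wall Schur correction `H_{Cl,Wl} H_{Wl,Wl}⁻¹ H_{Wl,Cl}` differs from the sum
of the per-collar corrections `Σ_k H_{Cl,Co k} H_{Co k,Co k}⁻¹ H_{Co k,Cl}` by a form of size
`12(2R+1)⁴ · 96 · (2/g₀) · (12(2R+1)⁴ · 96) · (2/g₀) e^{−(g₀/400)(W−1)} · 96` (`schur_lattice_locality`).

Proof (helpers in `…TipPricingSchurLatticeLocalityAux.lean`).  (1) Every principal block of `H` over a site set inside an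
embedded box with a norm gap `g` is invertible with `|block⁻¹_{pq}| ≤ (2/g) e^{−(g/400) dist}` in the box sup-distance
(`schurLoc_block_inv_decay`, Combes–Thomas).  (2) The wall is the disjoint union of the collars (`Wl ≃ Σ k, Co k`, from
`hin`/`hdisj`/`hcover` and uniqueness of box coordinates); the block-diagonal part `F` of the wall block `E` (entries inside
one collar) has inverse `⊕_k (F_k)⁻¹`, and `B F⁻¹ Bᴴ = Σ_k B_k F_k⁻¹ B_kᴴ` (`B = H_{Cl,Wl}`, `H` Hermitian).  (3) Resolvent
identity `E⁻¹ − F⁻¹ = −E⁻¹ (E − F) F⁻¹` (`norm_inv_sub_inv_apply_le`): `|E⁻¹| ≤ 2/g₀`, the rows of `E − F` (inter-collar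
hops) have sums `≤ 96`, and the relevant entries `F⁻¹_{z' y}` join a point `z'` on the OUTER FACE of its collar (it has a
neighbour in another collar) to a wall point `y` adjacent to a cell, i.e. within sup-distance `ℓ+1` of the collar centre,
so the collar Combes–Thomas bound decays over the distance `≥ W − 1`.  (4) The entry bound for `B (E⁻¹ − F⁻¹) Bᴴ`
(`norm_mul_mul_conjTranspose_apply_le`, row sums of `B` are `≤ 96`) and the crude form bound
(`abs_re_form_le_of_entry_le`) with `card Cl, card Wl ≤ 12 (2R+1)⁴`.  Supports stmt-QuantumFields-8967 (helper; closes no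
item).
-/

noncomputable section

namespace Summit.QuantumFields.QCD.Cruxes.TipPricing.ModularTemplate

open Matrix
open Literature.MathematicalPhysics.QuantumLattice Literature.MathematicalPhysics.QuantumFieldTheory
  Literature.Probability.LatticeModels
open Summit.QuantumFields.QCD.Theorems.ExtinctionBuildsQCD.Negative
open scoped BigOperators

variable {n : ℕ} [NeZero n]

/-! ### The stub -/

/-- **G6L.**  Torus of side `n`, big-box centre `c`, cell radius `ℓ`, collar width `W ≥ 2`, `r = ℓ+W`, an arbitrary finite
family of cell centres `z : Fin N → ℤ⁴` (box coordinates) whose cells-with-collars `z k + {−r..r}⁴` are pairwise disjoint and lie in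
the big box `{−R..R}⁴`, `2R+1 < n`.  Let `H = Γ₅ (D_W(U) − δ)`; `Cl` = quark indices over the union of the cells `z k + {−ℓ..ℓ}⁴`,
`Wl` = quark indices over the big box minus the cells (the wall ⊇ all collars), `Co k` = quark indices over collar `k`.
If the wall block and every collar block have norm gap `g₀ ∈ (0,1]` (as supplied by `wallBlock_gap_and_half`), then the Schur
complement of the wall differs from the sum of the per-cell collar Schur corrections by a form of size
`ε = 12·(2R+1)⁴ · (96 · (2/g₀) · (12 (2R+1)⁴ · 96) · ((2/g₀) · exp (−(g₀/400) · (W−1))) · 96)` on `Cl`-vectors. [folklore] -/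
theorem schur_lattice_locality (U : GaugeConfig 4 n SU3) (c : Fin 4 → ℤ) (ℓ W R N : ℕ) (hW : 2 ≤ W)
    (hR : 2 * R + 1 < n) (z : Fin N → (Fin 4 → ℤ))
    (hin : ∀ k, ∀ (y : Fin 4 → ℤ), y ∈ box 4 (ℓ + W) → z k + y ∈ box 4 R)
    (hdisj : ∀ k k', k ≠ k' → ∀ (y y' : Fin 4 → ℤ), y ∈ box 4 (ℓ + W) → y' ∈ box 4 (ℓ + W) → z k + y ≠ z k' + y')
    (hcover : ∀ (x : Fin 4 → ℤ), x ∈ box 4 R → ∃ (k : Fin N) (y : Fin 4 → ℤ), y ∈ box 4 (ℓ + W) ∧ x = z k + y)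
    (δ g₀ : ℝ) (hg₀ : 0 < g₀) (hg₀1 : g₀ ≤ 1) :
    let H := spinorLift gammaFive * wilsonDirac (fundamentalRep (Fin 3)) U (-δ) 1
    let Cl := {p : TorusSite 4 n × Fin 3 × Fin 4 // ∃ (k : Fin N) (y : ↥(box 4 ℓ)), Torus.proj n (c + z k + (y : Fin 4 → ℤ)) = p.1}
    let Wl := {p : TorusSite 4 n × Fin 3 × Fin 4 //
        (∃ (y : ↥(box 4 R)), Torus.proj n (c + (y : Fin 4 → ℤ)) = p.1) ∧
        ¬ ∃ (k : Fin N) (y : ↥(box 4 ℓ)), Torus.proj n (c + z k + (y : Fin 4 → ℤ)) = p.1}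
    let Co := fun k : Fin N => {p : TorusSite 4 n × Fin 3 × Fin 4 //
        (∃ (y : ↥(box 4 (ℓ + W))), Torus.proj n (c + z k + (y : Fin 4 → ℤ)) = p.1) ∧
        ¬ ∃ (y : ↥(box 4 ℓ)), Torus.proj n (c + z k + (y : Fin 4 → ℤ)) = p.1}
    (∀ v : Wl → ℂ, g₀ ^ 2 * ∑ i, ‖v i‖ ^ 2 ≤
        ∑ i, ‖((H.submatrix (Subtype.val : Wl → _) (Subtype.val : Wl → _)) *ᵥ v) i‖ ^ 2) →
    (∀ (k : Fin N) (v : Co k → ℂ), g₀ ^ 2 * ∑ i, ‖v i‖ ^ 2 ≤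
        ∑ i, ‖((H.submatrix (Subtype.val : Co k → _) (Subtype.val : Co k → _)) *ᵥ v) i‖ ^ 2) →
    ∀ v : Cl → ℂ,
      |(star v ⬝ᵥ ((H.submatrix (Subtype.val : Cl → _) (Subtype.val : Wl → _)) *
            (H.submatrix (Subtype.val : Wl → _) (Subtype.val : Wl → _))⁻¹ *
            (H.submatrix (Subtype.val : Wl → _) (Subtype.val : Cl → _)) -
          ∑ k : Fin N, (H.submatrix (Subtype.val : Cl → _) (Subtype.val : Co k → _)) *
            (H.submatrix (Subtype.val : Co k → _) (Subtype.val : Co k → _))⁻¹ *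
            (H.submatrix (Subtype.val : Co k → _) (Subtype.val : Cl → _))) *ᵥ v).re| ≤
        12 * (2 * (R : ℝ) + 1) ^ 4 * (96 * (2 / g₀) * (12 * (2 * (R : ℝ) + 1) ^ 4 * 96) *
          (2 / g₀ * Real.exp (-(g₀ / 400 * ((W : ℝ) - 1)))) * 96) * ∑ i, ‖v i‖ ^ 2 := by
  intro H Cl Wl Co hWgap hCgap v
  have hW1 : 1 ≤ W := le_trans (by norm_num) hW
  have hρ : ∀ g : SU3, fundamentalRep (Fin 3) g ∈ Matrix.unitaryGroup (Fin 3) ℂ := fundamentalRep_mem_unitaryGroup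
  have hHerm : H.IsHermitian :=
    Literature.Barriers.QuantumFields.isHermitian_gammaFive_mul_wilsonDirac _ hρ U (-δ) 1
  have hboxmono : box 4 ℓ ⊆ box 4 (ℓ + W) := box_mono 4 (Nat.le_add_right ℓ W)
  ---- (G) site geometry: extended cells are disjoint on the torus, collars ⊆ wall ⊆ ⋃ collars
  have hXuniq : ∀ (k k' : Fin N) (y y' : Fin 4 → ℤ), y ∈ box 4 (ℓ + W) → y' ∈ box 4 (ℓ + W) →
      Torus.proj n (c + z k + y) = Torus.proj n (c + z k' + y') → k = k' ∧ y = y' := by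
    intro k k' y y' hy hy' h
    rw [add_assoc, add_assoc] at h
    have heq := wallDecay_boxCoord_unique hR c (hin k y hy) (hin k' y' hy') h
    by_cases hk : k = k'
    · subst hk
      exact ⟨rfl, add_left_cancel heq⟩
    · exact absurd heq (hdisj k k' hk y y' hy hy')
  have hCoW : ∀ (k : Fin N) (x : TorusSite 4 n),
      ((∃ y : ↥(box 4 (ℓ + W)), Torus.proj n (c + z k + (y : Fin 4 → ℤ)) = x) ∧
        ¬ ∃ y : ↥(box 4 ℓ), Torus.proj n (c + z k + (y : Fin 4 → ℤ)) = x) →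
      (∃ y : ↥(box 4 R), Torus.proj n (c + (y : Fin 4 → ℤ)) = x) ∧
        ¬ ∃ (k : Fin N) (y : ↥(box 4 ℓ)), Torus.proj n (c + z k + (y : Fin 4 → ℤ)) = x := by
    rintro k x ⟨⟨⟨y, hy⟩, hx⟩, hnot⟩
    refine ⟨⟨⟨z k + y, hin k y hy⟩, by rw [← hx, add_assoc]⟩, ?_⟩
    rintro ⟨k', ⟨y', hy'⟩, hx'⟩
    obtain ⟨rfl, -⟩ := hXuniq k k' y y' hy (hboxmono hy') (hx.trans hx'.symm)
    exact hnot ⟨⟨y', hy'⟩, hx'⟩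
  have hWCo : ∀ x : Wl, ∃ k : Fin N,
      (∃ y : ↥(box 4 (ℓ + W)), Torus.proj n (c + z k + (y : Fin 4 → ℤ)) = x.1.1) ∧
        ¬ ∃ y : ↥(box 4 ℓ), Torus.proj n (c + z k + (y : Fin 4 → ℤ)) = x.1.1 := by
    rintro ⟨x, ⟨⟨y₀, hy₀⟩, hx⟩, hnot⟩
    obtain ⟨k, y, hy, hy₀eq⟩ := hcover y₀ hy₀
    refine ⟨k, ⟨⟨y, hy⟩, ?_⟩, fun ⟨y', hx'⟩ => hnot ⟨k, y', hx'⟩⟩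
    rw [add_assoc, ← hy₀eq]
    exact hx
  choose κ hκ using hWCo
  have hκu : ∀ (x : Wl) (k : Fin N),
      (∃ y : ↥(box 4 (ℓ + W)), Torus.proj n (c + z k + (y : Fin 4 → ℤ)) = x.1.1) → κ x = k := by
    rintro x k ⟨⟨y, hy⟩, hx⟩
    obtain ⟨⟨y', hy'⟩, hx'⟩ := (hκ x).1
    exact (hXuniq _ _ y' y hy' hy (hx'.trans hx.symm)).1
  -- the wall is the disjoint union of the collars
  obtain ⟨e, he, hes⟩ : ∃ e : Wl ≃ (Σ k, Co k), (∀ x, e x = ⟨κ x, ⟨x.1, hκ x⟩⟩) ∧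
      ∀ s, ((e.symm s : Wl) : TorusSite 4 n × Fin 3 × Fin 4) = (s.2 : TorusSite 4 n × Fin 3 × Fin 4) := by
    refine ⟨⟨fun x => ⟨κ x, ⟨x.1, hκ x⟩⟩, fun s => ⟨s.2.1, hCoW s.1 s.2.1.1 s.2.2⟩, fun x => rfl, fun s => ?_⟩,
      fun x => rfl, fun s => rfl⟩
    exact Sigma.subtype_ext (hκu ⟨s.2.1, hCoW s.1 s.2.1.1 s.2.2⟩ s.1 s.2.2.1) rfl
  ---- (CT) Combes–Thomas for the wall block `E` and the collar blocks `F_k`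
  have hWin : ∀ x : TorusSite 4 n, ((∃ y : ↥(box 4 R), Torus.proj n (c + (y : Fin 4 → ℤ)) = x) ∧
        ¬ ∃ (k : Fin N) (y : ↥(box 4 ℓ)), Torus.proj n (c + z k + (y : Fin 4 → ℤ)) = x) →
      ∃ y : Fin 4 → ℤ, y ∈ box 4 R ∧ Torus.proj n (c + y) = x :=
    fun x ⟨⟨⟨y, hy⟩, hx⟩, _⟩ => ⟨y, hy, hx⟩
  obtain ⟨hEu, hEdec⟩ := schurLoc_block_inv_decay U δ c R hR _ hWin hg₀ hg₀1 hWgap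
  have hcollarR : ∀ k : Fin N, 2 * (ℓ + W) + 1 < n := by
    intro k
    have h1 := (mem_box.1 (hin k (fun _ => ((ℓ + W : ℕ) : ℤ)) (mem_box.2 fun i => ⟨by omega, le_rfl⟩))) 0
    have h2 := (mem_box.1 (hin k (fun _ => -((ℓ + W : ℕ) : ℤ)) (mem_box.2 fun i => ⟨le_rfl, by omega⟩))) 0
    simp only [Pi.add_apply] at h1 h2
    omega
  have hCoin : ∀ (k : Fin N) (x : TorusSite 4 n),
      ((∃ y : ↥(box 4 (ℓ + W)), Torus.proj n (c + z k + (y : Fin 4 → ℤ)) = x) ∧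
        ¬ ∃ y : ↥(box 4 ℓ), Torus.proj n (c + z k + (y : Fin 4 → ℤ)) = x) →
      ∃ y : Fin 4 → ℤ, y ∈ box 4 (ℓ + W) ∧ Torus.proj n (c + z k + y) = x :=
    fun k x ⟨⟨⟨y, hy⟩, hx⟩, _⟩ => ⟨y, hy, hx⟩
  have hCT := fun k : Fin N =>
    schurLoc_block_inv_decay U δ (c + z k) (ℓ + W) (hcollarR k) _ (hCoin k) hg₀ hg₀1 (hCgap k)
  ---- the block-diagonal part `F` of the wall block and its inverse
  obtain ⟨Gb, hGb⟩ : ∃ Gb : Matrix (Σ k, Co k) (Σ k, Co k) ℂ,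
      Gb = blockDiagonal' fun k => (H.submatrix (Subtype.val : Co k → _) (Subtype.val : Co k → _))⁻¹ := ⟨_, rfl⟩
  obtain ⟨F, hF⟩ : ∃ F : Matrix Wl Wl ℂ,
      F = (blockDiagonal' fun k => H.submatrix (Subtype.val : Co k → _) (Subtype.val : Co k → _)).submatrix e e :=
    ⟨_, rfl⟩
  have hFG : F * Gb.submatrix e e = 1 := by
    rw [hF, hGb, submatrix_mul_equiv, ← blockDiagonal'_mul]
    have h1 : (fun k => H.submatrix (Subtype.val : Co k → _) (Subtype.val : Co k → _) *
        (H.submatrix (Subtype.val : Co k → _) (Subtype.val : Co k → _))⁻¹) = 1 :=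
      funext fun k => by rw [Pi.one_apply]; exact mul_nonsing_inv _ (hCT k).1
    rw [h1, blockDiagonal'_one, submatrix_one_equiv]
  have hFu : IsUnit F.det := isUnit_det_of_right_inverse hFG
  have hFinv : F⁻¹ = Gb.submatrix e e := inv_eq_right_inv hFG
  ---- abbreviations for the blocks in the goal
  set E : Matrix Wl Wl ℂ := H.submatrix (Subtype.val : Wl → _) (Subtype.val : Wl → _) with hE
  set B : Matrix Cl Wl ℂ := H.submatrix (Subtype.val : Cl → _) (Subtype.val : Wl → _) with hBdef
  set B' : Matrix Wl Cl ℂ := H.submatrix (Subtype.val : Wl → _) (Subtype.val : Cl → _) with hB'def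
  -- entries and row sums of the inter-collar part `E − F`
  have hT : ∀ x x' : Wl, (E - F) x x' = if κ x = κ x' then 0 else H x.1 x'.1 := by
    intro x x'
    rw [Matrix.sub_apply, hF, submatrix_apply, he x, he x']
    by_cases hk : κ x = κ x'
    · rw [if_pos hk, schurLoc_blockDiagonal'_submatrix_apply H _ _ _ hk]
      exact sub_self _
    · rw [if_neg hk, schurLoc_blockDiagonal'_apply_of_ne _ _ _ hk, sub_zero]
      rfl
  have hTrow : ∀ x : Wl, ∑ x', ‖(E - F) x x'‖ ≤ 96 := by
    intro x
    calc ∑ x', ‖(E - F) x x'‖ ≤ ∑ x' : Wl, (if x.1.1 ≠ x'.1.1 then ‖H x.1 x'.1‖ else 0) := by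
          refine Finset.sum_le_sum fun x' _ => ?_
          rw [hT]
          by_cases hs : x.1.1 = x'.1.1
          · have hk : κ x = κ x' := by
              refine hκu x (κ x') ?_
              obtain ⟨y, hy⟩ := (hκ x').1
              exact ⟨y, by rw [hs]; exact hy⟩
            rw [if_pos hk, norm_zero, if_neg (not_not.2 hs)]
          · rw [if_pos hs]
            split_ifs
            · rw [norm_zero]; exact norm_nonneg _
            · exact le_rfl
      _ = ∑ x' ∈ Finset.univ.filter (fun x' : Wl => x.1.1 ≠ x'.1.1), ‖H x.1 x'.1‖ := (Finset.sum_filter _ _).symm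
      _ ≤ 96 := schurLoc_rowSum_le U δ x.1 _ fun x' hx' => (Finset.mem_filter.1 hx').2
  have hBrow : ∀ p : Cl, ∑ x : Wl, ‖B p x‖ ≤ 96 := fun p =>
    schurLoc_rowSum_le U δ p.1 Finset.univ fun x _ h => x.2.2 (h ▸ p.2)
  have hEinv : ∀ x x' : Wl, ‖E⁻¹ x x'‖ ≤ 2 / g₀ := by
    intro x x'
    obtain ⟨y, hy, hx⟩ := hWin x.1.1 x.2
    obtain ⟨y', hy', hx'⟩ := hWin x'.1.1 x'.2
    refine (hEdec x x' y y' hy hy' hx hx').trans ?_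
    have h1 : Real.exp (-(g₀ / 400 * ((Finset.univ.sup fun i : Fin 4 => (y i - y' i).natAbs : ℕ) : ℝ))) ≤ 1 :=
      Real.exp_le_one_iff.2 (neg_nonpos.2 (by positivity))
    calc 2 / g₀ * Real.exp (-(g₀ / 400 * ((Finset.univ.sup fun i : Fin 4 => (y i - y' i).natAbs : ℕ) : ℝ)))
        ≤ 2 / g₀ * 1 := mul_le_mul_of_nonneg_left h1 (by positivity)
      _ = 2 / g₀ := mul_one _
  ---- the decay of the collar resolvents across a collar
  set Bw : ℝ := 2 / g₀ * Real.exp (-(g₀ / 400 * ((W : ℝ) - 1))) with hBw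
  have hBw0 : 0 ≤ Bw := by positivity
  have hGbnd : ∀ s t : Σ k, Co k,
      (∃ x : Wl, κ x ≠ s.1 ∧ H x.1 s.2.1 ≠ 0) → (∃ q : Cl, H q.1 t.2.1 ≠ 0) → ‖Gb s t‖ ≤ Bw := by
    rintro ⟨k, i⟩ ⟨k', j⟩ ⟨x, hxk, hxi⟩ ⟨q, hqj⟩
    rw [hGb]
    by_cases hkk : k = k'
    · subst hkk
      rw [blockDiagonal'_apply_eq]
      obtain ⟨⟨⟨y', hy'⟩, hi⟩, -⟩ := i.2
      obtain ⟨⟨⟨y₂, hy₂⟩, hj⟩, -⟩ := j.2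
      refine ((hCT k).2 i j y' y₂ hy' hy₂ hi hj).trans ?_
      rw [hBw]
      refine mul_le_mul_of_nonneg_left (Real.exp_le_exp.2 (neg_le_neg (mul_le_mul_of_nonneg_left
        (schurLoc_supDist_ge (ℓ := ℓ) ?_ ?_) (by positivity)))) (by positivity)
      · -- `i` lies on the outer face of collar `k`: it has the neighbour `x` in collar `κ x ≠ k`
        obtain ⟨⟨⟨y₀, hy₀⟩, hx0⟩, -⟩ := hκ x
        have hop := schurLoc_H_hop U δ x.1 i.1 hxi
        have ex : x.1.1 = Torus.proj n (c + (z (κ x) + y₀)) := by rw [← add_assoc]; exact hx0.symm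
        have ei : i.1.1 = Torus.proj n (c + (z k + y')) := by rw [← add_assoc]; exact hi.symm
        rw [ex, ei] at hop
        exact schurLoc_outerFace z hdisj hxk hy' hy₀ (schurLoc_latticeAdj hR c (hin _ _ hy₀) (hin _ _ hy') hop)
      · -- `j` is adjacent to the cell index `q`
        obtain ⟨k₁, ⟨y₁, hy₁⟩, hq⟩ := q.2
        have hop := schurLoc_H_hop U δ q.1 j.1 hqj
        have eq1 : q.1.1 = Torus.proj n (c + (z k₁ + y₁)) := by rw [← add_assoc]; exact hq.symm
        have ej : j.1.1 = Torus.proj n (c + (z k + y₂)) := by rw [← add_assoc]; exact hj.symm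
        rw [eq1, ej] at hop
        exact schurLoc_cellAdjacent hW1 z hdisj hy₁ hy₂
          (schurLoc_latticeAdj hR c (hin _ _ (hboxmono hy₁)) (hin _ _ hy₂) hop)
    · rw [blockDiagonal'_apply_ne _ _ _ hkk, norm_zero]
      exact hBw0
  have hcut : ∀ (q : Cl) (y : Wl), B q y ≠ 0 → ∀ x x' : Wl, (E - F) x x' ≠ 0 → ‖F⁻¹ x' y‖ ≤ Bw := by
    intro q y hqy x x' hxx'
    rw [hT] at hxx'
    by_cases hk : κ x = κ x'
    · rw [if_pos hk] at hxx'
      exact absurd rfl hxx'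
    · rw [if_neg hk] at hxx'
      rw [hFinv, submatrix_apply, he x', he y]
      exact hGbnd _ _ ⟨x, hk, hxx'⟩ ⟨q, hqy⟩
  ---- the identity `B E⁻¹ B' − Σ_k B_k F_k⁻¹ B_k' = B (E⁻¹ − F⁻¹) Bᴴ`
  have hBH : B' = Bᴴ := by
    ext x q
    rw [conjTranspose_apply, hBdef, hB'def, submatrix_apply, submatrix_apply, hHerm.apply]
  have hsum2 : ∀ φ : Wl → Wl → ℂ, ∑ x, ∑ y, φ x y = ∑ s, ∑ t, φ (e.symm s) (e.symm t) := fun φ => by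
    rw [← e.symm.sum_comp]
    exact Finset.sum_congr rfl fun s _ => (e.symm.sum_comp _).symm
  have hblock : B * F⁻¹ * B' =
      ∑ k : Fin N, (H.submatrix (Subtype.val : Cl → _) (Subtype.val : Co k → _)) *
        (H.submatrix (Subtype.val : Co k → _) (Subtype.val : Co k → _))⁻¹ *
        (H.submatrix (Subtype.val : Co k → _) (Subtype.val : Cl → _)) := by
    rw [hFinv]
    ext p q
    rw [Matrix.sum_apply]
    simp only [mul_apply, Finset.sum_mul]
    rw [Finset.sum_comm, hsum2]
    simp only [hBdef, hB'def, submatrix_apply, Equiv.apply_symm_apply, hes, hGb]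
    rw [schurLoc_sum_sigma_blockDiagonal']
    exact Finset.sum_congr rfl fun k _ => Finset.sum_comm
  have hM : B * E⁻¹ * B' -
      ∑ k : Fin N, (H.submatrix (Subtype.val : Cl → _) (Subtype.val : Co k → _)) *
        (H.submatrix (Subtype.val : Co k → _) (Subtype.val : Co k → _))⁻¹ *
        (H.submatrix (Subtype.val : Co k → _) (Subtype.val : Cl → _)) = B * (E⁻¹ - F⁻¹) * Bᴴ := by
    rw [Matrix.mul_sub, Matrix.sub_mul, ← hBH, hblock]
  ---- entry bound, form bound, constants
  have hBd0 : 0 ≤ 2 / g₀ * (Fintype.card Wl * 96) * Bw := by positivity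
  have hentry : ∀ p q : Cl, ‖(B * (E⁻¹ - F⁻¹) * Bᴴ) p q‖ ≤ 96 * (2 / g₀ * (Fintype.card Wl * 96) * Bw) * 96 :=
    fun p q => norm_mul_mul_conjTranspose_apply_le _ _ p q hBd0 (hBrow p) (hBrow q) fun x y _ hqy =>
      norm_inv_sub_inv_apply_le E F hEu hFu x y (by positivity) hBw0 hEinv hTrow (hcut q y hqy)
  have hform := abs_re_form_le_of_entry_le (B * (E⁻¹ - F⁻¹) * Bᴴ) (by positivity) hentry v
  rw [hM]
  refine hform.trans (mul_le_mul_of_nonneg_right ?_ (Finset.sum_nonneg fun i _ => by positivity))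
  -- (the site predicates are passed explicitly: they are not higher-order patterns of the index)
  have hcW := schurLoc_card_le (R := R) c (fun x : TorusSite 4 n =>
    (∃ y : ↥(box 4 R), Torus.proj n (c + (y : Fin 4 → ℤ)) = x) ∧
      ¬ ∃ (k : Fin N) (y : ↥(box 4 ℓ)), Torus.proj n (c + z k + (y : Fin 4 → ℤ)) = x) hWin
  have hcC := schurLoc_card_le (R := R) c
    (fun x : TorusSite 4 n => ∃ (k : Fin N) (y : ↥(box 4 ℓ)), Torus.proj n (c + z k + (y : Fin 4 → ℤ)) = x)
    fun x ⟨k, ⟨y, hy⟩, hx⟩ => ⟨z k + y, hin k y (hboxmono hy), by rw [← add_assoc]; exact hx⟩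
  calc 96 * (2 / g₀ * (Fintype.card Wl * 96) * Bw) * 96 * (Fintype.card Cl : ℝ)
      = (Fintype.card Cl : ℝ) * (96 * (2 / g₀) * ((Fintype.card Wl : ℝ) * 96) * Bw * 96) := by ring
    _ ≤ 12 * (2 * (R : ℝ) + 1) ^ 4 * (96 * (2 / g₀) * (12 * (2 * (R : ℝ) + 1) ^ 4 * 96) * Bw * 96) := by
        gcongr

end Summit.QuantumFields.QCD.Cruxes.TipPricing.ModularTemplate

end
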